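import Literature.AlgebraicGeometry.Resolution.Dehomogenization
import Mathlib.RingTheory.MvPolynomial.Basic
import Mathlib.RingTheory.Localization.AtPrime.Basic
import Mathlib.RingTheory.RegularLocalRing.Defs
import HarnessLib

/-!
# [OURS · L1 W4.5(b) · EL♮(3)] (δ) D5 MEMBER_S, ring-level preparations: (a) the reduced-cone relations of `CarrierCluster₂` transported
# from the residue model `k'` to the quotient `𝒪_{F₁,x}/(c̄)`; (b) D1's «prime ≠ excluded point ideal» exclusions in POINTED form

Crux chain w45b (cell `res-hironaka`, slot W4.5(b)), working crux **EL♮** = stmt-ResolutionOfSingularities-20038, child **EL♮(3)** =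
stmt-ResolutionOfSingularities-20148, route EquisingularLift, line `sections`, registered stub `stub_elnat_tcPlusPlusPointResolution` (v2);
brick **(δ) D5 MEMBER_S** (res-L1-w45b-stub-3 `DELTA-PLAN.md`; res-L1-w45b-plan-1 BOOKING 2026-08-27T16:20:41Z: D5/D6 := res-type-100).
HONEST FRAMING: OURS; NOT a statement of any manuscript; AI-written, weaker than expert review. No `sorry`; standard axioms. DEF-FREE.
`--supports stmt-ResolutionOfSingularities-20148 --as helper`. Pure commutative algebra (no schemes).

WHAT (namespace `…Cruxes.EquisingularLiftNat.Sections`).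
* `reducedCone_relations_of_residueModel` — for `πk : R ↠ k'` with `ker πk = (c)`, forms `Φ₁, G ∈ R[T]` and `g = πk_* G`: the relations
  (R1) `πk_* Φ₁ ∈ √(g)`, `g ∈ √(πk_* Φ₁)`, (R2) `(g(T_j := 1))` radical, and `g ≠ 0` — `ReducedConeForm`'s clauses (res-L1-w45b-lead-2
  …NatClusterStepDefs p531557) — hold VERBATIM for the reductions modulo `(c)` (the currency of res-type-097's T-TCONE
  `vanishingIdeal_carrierTrace_eq_strictTransformIdeal_sup_comap` and res-L1-w45b-stub-2's `finite_badPrimes…`), along `R/(c) ≅ k'`.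
* `comap_span_ne_of_pointed_exclusion` — the POINTED exclusion «`¬ ∀ l′, [T_l′ − b_l′] ∈ Q`» (res-type-100 …NatCarrierDeltaPointed p553722)
  implies D1's exclusion «`(T_l′ − π b_l′ : l′)·k[T] pulled back along π ≠ Q ∩ O[T]`» (res-L1-w45b-stub-3 `exists_clusterConeLift_subset`,
  p548257, clause 5); packaged as **`deltaClause_pointed_of_comap_ne`**: D1's chart clause ⟹ the `hΔ` input of
  `isRegularLocalRing_quotient_carrierDelta_of_goodChart` (…NatCarrierDeltaOffCluster) for any lifts of the excluded coordinate vectors.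

References: res-L1-w45b-lead-2 …NatClusterStepDefs (p531557); res-L1-w45b-stub-3 …NatClusterConeSubset (p548257) [cite: Matsumura1987, Thm. 14.2].
-/

set_option linter.dupNamespace false -- mandated namespace `Summit.<Summit>.<Problem>` of this single-conjunct summit

noncomputable section

open IsLocalRing MvPolynomial
open Literature.AlgebraicGeometry.Resolution (dehomogenize map_dehomogenize)

namespace Summit.ResolutionOfSingularities.ResolutionOfSingularities.Cruxes.EquisingularLiftNat.Sections

/-! ## (a) Transport of the reduced-cone relations along `R/(c) ≅ k'` -/

/-- Radical membership of principal ideals transports along a ring isomorphism. [folklore] -/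
theorem mem_radical_span_singleton_map_ringEquiv {A B : Type*} [CommRing A] [CommRing B] (e : A ≃+* B) {f g : A}
    (h : f ∈ (Ideal.span {g}).radical) : e f ∈ (Ideal.span {e g}).radical := by
  obtain ⟨n, hn⟩ := h
  obtain ⟨r, hr⟩ := Ideal.mem_span_singleton'.mp hn
  exact ⟨n, Ideal.mem_span_singleton'.mpr ⟨e r, by rw [← map_pow, ← hr, map_mul]⟩⟩

/-- Radicality of a principal ideal transports along a ring isomorphism. [folklore] -/
theorem isRadical_span_singleton_map_ringEquiv {A B : Type*} [CommRing A] [CommRing B] (e : A ≃+* B) {g : A}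
    (h : (Ideal.span {g}).IsRadical) : (Ideal.span {e g}).IsRadical := by
  intro f hf
  have h1 : e.symm f ∈ (Ideal.span {g}).radical := by
    have := mem_radical_span_singleton_map_ringEquiv e.symm hf
    rwa [RingEquiv.symm_apply_apply] at this
  have h2 := h h1
  obtain ⟨r, hr⟩ := Ideal.mem_span_singleton'.mp h2
  refine Ideal.mem_span_singleton'.mpr ⟨e r, ?_⟩
  have := congrArg e hr
  rwa [map_mul, RingEquiv.apply_symm_apply] at this

set_option maxHeartbeats 400000 in -- polynomial rings over a quotient ring: slow instance paths (cf. p526020 DESIGN NOTE)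
/-- **The reduced-cone relations transported from the residue model to the quotient by the frame** (see the module docstring).
[cite: Matsumura1987, Thm. 14.2] [OURS · L1 W4.5b] (δ) D5 prep; NOT a statement of the manuscript. -/
theorem reducedCone_relations_of_residueModel {R k' : Type} [CommRing R] [Field k'] {r : ℕ} (c : Fin r → R)
    (πk : R →+* k') (hπk : Function.Surjective πk) (hker : RingHom.ker πk = Ideal.span (Set.range c))
    (Φ₁ G : MvPolynomial (Fin r) R) {g : MvPolynomial (Fin r) k'} (hGg : MvPolynomial.map πk G = g)
    (hR1 : MvPolynomial.map πk Φ₁ ∈ (Ideal.span {g}).radical)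
    (hR1' : g ∈ (Ideal.span {MvPolynomial.map πk Φ₁}).radical)
    (hR2 : ∀ j : Fin r, (Ideal.span {dehomogenize j g}).IsRadical) (hg0 : g ≠ 0) :
    MvPolynomial.map (Ideal.Quotient.mk (Ideal.span (Set.range c))) Φ₁ ∈
        (Ideal.span {MvPolynomial.map (Ideal.Quotient.mk (Ideal.span (Set.range c))) G}).radical ∧
      MvPolynomial.map (Ideal.Quotient.mk (Ideal.span (Set.range c))) G ∈
        (Ideal.span {MvPolynomial.map (Ideal.Quotient.mk (Ideal.span (Set.range c))) Φ₁}).radical ∧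
      (∀ j : Fin r, (Ideal.span {MvPolynomial.map (Ideal.Quotient.mk (Ideal.span (Set.range c)))
        (dehomogenize j G)}).IsRadical) ∧
      MvPolynomial.map (Ideal.Quotient.mk (Ideal.span (Set.range c))) G ≠ 0 := by
  -- `ek : R/(c) ≅ k'` along `πk`, and the induced isomorphisms of polynomial rings
  let ek : (R ⧸ Ideal.span (Set.range c)) ≃+* k' :=
    (Ideal.quotEquivOfEq hker.symm).trans (RingHom.quotientKerEquivOfSurjective hπk)
  have hek : ∀ a, ek (Ideal.Quotient.mk (Ideal.span (Set.range c)) a) = πk a := fun a => by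
    change RingHom.quotientKerEquivOfSurjective hπk (Ideal.quotEquivOfEq hker.symm (Ideal.Quotient.mk _ a)) = πk a
    rw [Ideal.quotEquivOfEq_mk, RingHom.quotientKerEquivOfSurjective_apply_mk]
  have hcomp : (ek : _ →+* k').comp (Ideal.Quotient.mk (Ideal.span (Set.range c))) = πk := RingHom.ext hek
  have hE : ∀ (σ : Type) (P : MvPolynomial σ R), (MvPolynomial.mapEquiv σ ek).symm (MvPolynomial.map πk P) =
      MvPolynomial.map (Ideal.Quotient.mk (Ideal.span (Set.range c))) P := by
    intro σ P
    apply (MvPolynomial.mapEquiv σ ek).injective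
    rw [RingEquiv.apply_symm_apply, MvPolynomial.mapEquiv_apply, MvPolynomial.map_map, hcomp]
  have hΦ₁ := hE (Fin r) Φ₁
  have hG := hE (Fin r) G
  rw [hGg] at hG
  refine ⟨?_, ?_, fun j => ?_, ?_⟩
  · have := mem_radical_span_singleton_map_ringEquiv (MvPolynomial.mapEquiv (Fin r) ek).symm hR1
    rwa [hΦ₁, hG] at this
  · have := mem_radical_span_singleton_map_ringEquiv (MvPolynomial.mapEquiv (Fin r) ek).symm hR1'
    rwa [hΦ₁, hG] at this
  · have := isRadical_span_singleton_map_ringEquiv (MvPolynomial.mapEquiv {l : Fin r // l ≠ j} ek).symm (hR2 j)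
    have hGj := hE {l : Fin r // l ≠ j} (dehomogenize j G)
    rw [map_dehomogenize, hGg] at hGj
    rwa [hGj] at this
  · rw [← hG]
    exact fun h => hg0 ((map_eq_zero_iff _ (MvPolynomial.mapEquiv (Fin r) ek).symm.injective).mp h)

/-! ## (b) D1's exclusions in pointed form -/

/-- **The pointed exclusion implies D1's exclusion.** `π : O → k`, `Q` an ideal of `O[T_l′ : l′ ≠ l]/(f)`; if `Q` does not contain the
whole family `[T_l′ − b_l′]`, then the preimage of the `k`-point ideal `(T_l′ − π b_l′)` along `π_*` is not `Q ∩ O[T]` (each `T_l′ − b_l′`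
lies in that preimage). [folklore] -/
theorem comap_span_ne_of_pointed_exclusion {O k : Type} [CommRing O] [CommRing k] (π : O →+* k) {σ : Type}
    (f : MvPolynomial σ O) (Q : Ideal (MvPolynomial σ O ⧸ Ideal.span {f})) (β : σ → k) (b : σ → O)
    (hb : ∀ l, π (b l) = β l) (hpt : ¬ ∀ l, Ideal.Quotient.mk (Ideal.span {f}) (X l - C (b l)) ∈ Q) :
    (Ideal.span (Set.range fun l : σ => (X l : MvPolynomial σ k) - C (β l))).comap (MvPolynomial.map π) ≠
      Q.comap (Ideal.Quotient.mk (Ideal.span {f})) := by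
  intro heq
  apply hpt
  intro l
  rw [← Ideal.mem_comap, ← heq, Ideal.mem_comap, map_sub, MvPolynomial.map_X, MvPolynomial.map_C, hb]
  exact Ideal.subset_span ⟨l, rfl⟩

/-- **D1's chart clause in POINTED form.** res-L1-w45b-stub-3's standard-chart Δ-clause of `exists_clusterConeLift_subset` (p548257, clause 5)
on the chart `j` — regular at every prime `Q ∋ C ϖ` whose trace on `O[T]` is none of the pulled-back point ideals of the EXCLUDED members
(`â_t j ≠ 0 ∧ (t ∈ S ∨ i t ≠ j)`) — yields the `hΔ` input of res-type-100's `isRegularLocalRing_quotient_carrierDelta_of_goodChart`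
(…NatCarrierDeltaOffCluster): regular at every `Q ∋ C ϖ` not containing a whole family `[T_l′ − bO_e l′]`, for ANY lifts `bO_e` of the
excluded coordinate vectors `â_t/â_t j`. [cite: Matsumura1987, Thm. 14.2] [OURS · L1 W4.5b] (δ) D5 prep; NOT a statement of the manuscript. -/
theorem deltaClause_pointed_of_comap_ne {O k : Type} [CommRing O] [Field k] (π : O →+* k) (ϖ : O) {s : ℕ}
    (i : Fin s → Fin 3) (a : (t : Fin s) → {j : Fin 3 // j ≠ i t} → O) (S : Set (Fin s)) (j : Fin 3)
    (f : MvPolynomial {l : Fin 3 // l ≠ j} O)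
    (hD1 : ∀ (Q : Ideal (MvPolynomial {l : Fin 3 // l ≠ j} O ⧸ Ideal.span {f})) [Q.IsPrime],
      Ideal.Quotient.mk (Ideal.span {f}) (C ϖ : MvPolynomial {l : Fin 3 // l ≠ j} O) ∈ Q →
      (∀ t : Fin s, (if h : j = i t then (1 : k) else π (a t ⟨j, h⟩)) ≠ 0 → (t ∈ S ∨ i t ≠ j) →
        (Ideal.span (Set.range fun l : {l : Fin 3 // l ≠ j} =>
          (X l : MvPolynomial {l : Fin 3 // l ≠ j} k) -
            C ((if h : (l : Fin 3) = i t then (1 : k) else π (a t ⟨l, h⟩)) /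
              (if h : j = i t then (1 : k) else π (a t ⟨j, h⟩))))).comap (MvPolynomial.map (σ := {l : Fin 3 // l ≠ j}) π) ≠
        Q.comap (Ideal.Quotient.mk (Ideal.span {f}))) →
      IsRegularLocalRing (Localization.AtPrime Q))
    (bO : {t : Fin s // (if h : j = i t then (1 : k) else π (a t ⟨j, h⟩)) ≠ 0 ∧ (t ∈ S ∨ i t ≠ j)} →
      {l : Fin 3 // l ≠ j} → O)
    (hbO : ∀ e l, π (bO e l) = (if h : (l : Fin 3) = i e.1 then (1 : k) else π (a e.1 ⟨l, h⟩)) /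
      (if h : j = i e.1 then (1 : k) else π (a e.1 ⟨j, h⟩))) :
    ∀ (Q : Ideal (MvPolynomial {l : Fin 3 // l ≠ j} O ⧸ Ideal.span {f})) [Q.IsPrime],
      Ideal.Quotient.mk (Ideal.span {f}) (C ϖ : MvPolynomial {l : Fin 3 // l ≠ j} O) ∈ Q →
      (∀ e, ¬ ∀ l, Ideal.Quotient.mk (Ideal.span {f}) (X l - C (bO e l)) ∈ Q) →
        IsRegularLocalRing (Localization.AtPrime Q) := by
  intro Q _ hϖ hex
  refine hD1 Q hϖ fun t ht htS => ?_
  exact comap_span_ne_of_pointed_exclusion π f Q _ (bO ⟨t, ht, htS⟩) (fun l => hbO ⟨t, ht, htS⟩ l) (hex ⟨t, ht, htS⟩)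

end Summit.ResolutionOfSingularities.ResolutionOfSingularities.Cruxes.EquisingularLiftNat.Sections

end
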